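import Mathlib

/-!
# Route BarrierLever — item `SeparableDescentCertificatesExist` (stmt-ValiantsHypothesis-19536):
# REFUTED (the order- and bit-dependent separable descent certificate does not always exist)

Refutation file (`theorem not_separableDescentCertificatesExist : ¬ <signature verbatim>`, closing the
item `--as refuted`; rung V4, 𝒟-side; seat val-lit-p1 g2; the falsity was announced by the item's
author, planner valiant-natproofs p1-g9 (bus 2026-08-26T08:53Z: «the WHOLE pure descent scheme is
refuted … the antipodal star … has rows 0 / e_mid with identical label sets under every order»), who
filed negation items only for the general scheme (19579, proved by prover gen 6) and for the
bit-free lexicographic case (19537, proved by this seat); this file records the separable case in the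
tree. Scaffold adapted from `BarrierLeverDescentCertificatesFail.lean` (gen 6). Definition-free.

The item asserts: «for every injective layout `(u, w)` there are a coordinate order `ord`, threshold
profiles `F, G : position × bit → ℕ` and an assignment `π₀` (fixing the common points) whose cost —
the sum over unmatched columns `j` of
`min_{a ≥ maxpos Δ_j} F(a, [ord⁻¹ a ∈ u(π₀ j)]) + min_{c ≤ minpos Δ_j} G(c, [ord⁻¹ c ∈ w j])` — is
STRICTLY smaller than that of every other admissible assignment».

**Counterexample (the antipodal star, `h = 5`, `r = 6`).** Rows `U = {∅, {0}, …, {4}}`, columns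
`W = {univ ∖ {k}} ∪ {univ}`; no row is a column. Fix `ord, F, G, π₀`, let `x = ord⁻¹(2)`. For
every column `W_j` the mismatch sets of the rows `∅` and `{x}` are `W_j` and `W_j Δ {x}`; both
contain a coordinate of position `≥ 3` and one of position `≤ 1` and differ only at position `2`,
so the admissible position sets `{a : a ≥ every mismatch position}` and `{c : c ≤ every mismatch
position}` COINCIDE for the two rows (`upper_iff`, `lower_iff`); on the first set `a ≥ 3 ≠ 2`, so
the row bit `[ord⁻¹ a ∈ row]` is `false` for both rows, and the column bit does not see the row —
hence both minima agree (`sep_terms_eq`) and `σ = π₀ ∘ (j₁ j₂)` has the SAME cost as `π₀`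
(`not_separableDescentCertificatesExist`). CLASS: refuted-substantive — no order and no separable
bit-dependent thresholds distinguish the two rows; the planner's repair is a different scheme
(CHAIN certificates), not a side condition.

WHAT THIS IS NOT: nothing on UT-D (stmt-19316), 19573, TT / TNS / 19717, crux 14610, or VP vs VNP.
-/

-- layout Summits/ValiantsHypothesis/ValiantsHypothesis forces the duplicated namespace component
set_option linter.dupNamespace false

namespace Summit.ValiantsHypothesis.ValiantsHypothesis.Theorems.BarrierLever.SeparableDescentFail

open Finset

/-- Upper admissible positions agree for the rows `∅` and `{ord⁻¹ 2}` against a column missing at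
most one coordinate. -/
theorem upper_iff (ord : Equiv.Perm (Fin 5)) (W : Finset (Fin 5))
    (hW : ∀ y z : Fin 5, y ≠ z → y ∈ W ∨ z ∈ W) (a : Fin 5) :
    (∀ m : Fin 5, (m ∈ ({ord.symm 2} : Finset (Fin 5)) ↔ m ∉ W) → ((ord m : Fin 5) : ℕ) ≤ (a : ℕ)) ↔
      (∀ m : Fin 5, (m ∈ (∅ : Finset (Fin 5)) ↔ m ∉ W) → ((ord m : Fin 5) : ℕ) ≤ (a : ℕ)) := by
  obtain ⟨p, hp3, hpW⟩ : ∃ p : Fin 5, 3 ≤ (p : ℕ) ∧ ord.symm p ∈ W := by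
    rcases hW (ord.symm 3) (ord.symm 4) (by rw [Ne, ord.symm.injective.eq_iff]; decide) with h3 | h4
    · exact ⟨3, le_rfl, h3⟩
    · exact ⟨4, by decide, h4⟩
  have hp2 : ord.symm p ≠ ord.symm 2 := by
    rw [Ne, ord.symm.injective.eq_iff]; rintro rfl; exact absurd hp3 (by decide)
  have hpos2 : ((ord (ord.symm 2) : Fin 5) : ℕ) = 2 := by rw [Equiv.apply_symm_apply]; rfl
  have hposp : ((ord (ord.symm p) : Fin 5) : ℕ) = p := by rw [Equiv.apply_symm_apply]
  simp only [Finset.mem_singleton, Finset.notMem_empty, false_iff, not_not]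
  constructor
  · intro h m hmW
    by_cases hmx : m = ord.symm 2
    · subst hmx
      have := h (ord.symm p) (by simp only [hp2, hpW, not_true_eq_false])
      rw [hposp] at this
      rw [hpos2]; omega
    · exact h m (by simp only [hmx, false_iff, not_not]; exact hmW)
  · intro h m hm
    by_cases hmx : m = ord.symm 2
    · subst hmx
      have := h (ord.symm p) hpW
      rw [hposp] at this
      rw [hpos2]; omega
    · exact h m (by simpa only [hmx, false_iff, not_not] using hm)

/-- Lower admissible positions agree for the rows `∅` and `{ord⁻¹ 2}` against a column missing at
most one coordinate. -/
theorem lower_iff (ord : Equiv.Perm (Fin 5)) (W : Finset (Fin 5))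
    (hW : ∀ y z : Fin 5, y ≠ z → y ∈ W ∨ z ∈ W) (c : Fin 5) :
    (∀ m : Fin 5, (m ∈ ({ord.symm 2} : Finset (Fin 5)) ↔ m ∉ W) → (c : ℕ) ≤ ((ord m : Fin 5) : ℕ)) ↔
      (∀ m : Fin 5, (m ∈ (∅ : Finset (Fin 5)) ↔ m ∉ W) → (c : ℕ) ≤ ((ord m : Fin 5) : ℕ)) := by
  obtain ⟨p, hp1, hpW⟩ : ∃ p : Fin 5, (p : ℕ) ≤ 1 ∧ ord.symm p ∈ W := by
    rcases hW (ord.symm 0) (ord.symm 1) (by rw [Ne, ord.symm.injective.eq_iff]; decide) with h0 | h1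
    · exact ⟨0, by decide, h0⟩
    · exact ⟨1, le_rfl, h1⟩
  have hp2 : ord.symm p ≠ ord.symm 2 := by
    rw [Ne, ord.symm.injective.eq_iff]; rintro rfl; exact absurd hp1 (by decide)
  have hpos2 : ((ord (ord.symm 2) : Fin 5) : ℕ) = 2 := by rw [Equiv.apply_symm_apply]; rfl
  have hposp : ((ord (ord.symm p) : Fin 5) : ℕ) = p := by rw [Equiv.apply_symm_apply]
  simp only [Finset.mem_singleton, Finset.notMem_empty, false_iff, not_not]
  constructor
  · intro h m hmW
    by_cases hmx : m = ord.symm 2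
    · subst hmx
      have := h (ord.symm p) (by simp only [hp2, hpW, not_true_eq_false])
      rw [hposp] at this
      rw [hpos2]; omega
    · exact h m (by simp only [hmx, false_iff, not_not]; exact hmW)
  · intro h m hm
    by_cases hmx : m = ord.symm 2
    · subst hmx
      have := h (ord.symm p) hpW
      rw [hposp] at this
      rw [hpos2]; omega
    · exact h m (by simpa only [hmx, false_iff, not_not] using hm)

/-- **Key lemma.** Against a column `W ⊆ Fin 5` missing at most one coordinate, the rows `∅` and
`{ord⁻¹ 2}` have the same separable descent cost for every order and all threshold profiles. -/
theorem sep_terms_eq (ord : Equiv.Perm (Fin 5)) (F G : Fin 5 → Bool → ℕ) (W : Finset (Fin 5))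
    (hW : ∀ y z : Fin 5, y ≠ z → y ∈ W ∨ z ∈ W) :
    sInf ((fun a : Fin 5 => F a (decide (ord.symm a ∈ ({ord.symm 2} : Finset (Fin 5))))) ''
        {a : Fin 5 | ∀ m : Fin 5, (m ∈ ({ord.symm 2} : Finset (Fin 5)) ↔ m ∉ W) →
          ((ord m : Fin 5) : ℕ) ≤ (a : ℕ)}) +
      sInf ((fun c : Fin 5 => G c (decide (ord.symm c ∈ W))) ''
        {c : Fin 5 | ∀ m : Fin 5, (m ∈ ({ord.symm 2} : Finset (Fin 5)) ↔ m ∉ W) →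
          (c : ℕ) ≤ ((ord m : Fin 5) : ℕ)}) =
    sInf ((fun a : Fin 5 => F a (decide (ord.symm a ∈ (∅ : Finset (Fin 5))))) ''
        {a : Fin 5 | ∀ m : Fin 5, (m ∈ (∅ : Finset (Fin 5)) ↔ m ∉ W) →
          ((ord m : Fin 5) : ℕ) ≤ (a : ℕ)}) +
      sInf ((fun c : Fin 5 => G c (decide (ord.symm c ∈ W))) ''
        {c : Fin 5 | ∀ m : Fin 5, (m ∈ (∅ : Finset (Fin 5)) ↔ m ∉ W) →
          (c : ℕ) ≤ ((ord m : Fin 5) : ℕ)}) := by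
  have hA : {a : Fin 5 | ∀ m : Fin 5, (m ∈ ({ord.symm 2} : Finset (Fin 5)) ↔ m ∉ W) →
        ((ord m : Fin 5) : ℕ) ≤ (a : ℕ)} =
      {a : Fin 5 | ∀ m : Fin 5, (m ∈ (∅ : Finset (Fin 5)) ↔ m ∉ W) →
        ((ord m : Fin 5) : ℕ) ≤ (a : ℕ)} := Set.ext fun a => upper_iff ord W hW a
  have hC : {c : Fin 5 | ∀ m : Fin 5, (m ∈ ({ord.symm 2} : Finset (Fin 5)) ↔ m ∉ W) →
        (c : ℕ) ≤ ((ord m : Fin 5) : ℕ)} =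
      {c : Fin 5 | ∀ m : Fin 5, (m ∈ (∅ : Finset (Fin 5)) ↔ m ∉ W) →
        (c : ℕ) ≤ ((ord m : Fin 5) : ℕ)} := Set.ext fun c => lower_iff ord W hW c
  rw [hA, hC]
  congr 1
  refine congrArg sInf (Set.image_congr fun a ha => ?_)
  -- on the upper admissible set `a ≥ 3`, so the row bit is `false` for both rows
  obtain ⟨p, hp3, hpW⟩ : ∃ p : Fin 5, 3 ≤ (p : ℕ) ∧ ord.symm p ∈ W := by
    rcases hW (ord.symm 3) (ord.symm 4) (by rw [Ne, ord.symm.injective.eq_iff]; decide) with h3 | h4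
    · exact ⟨3, le_rfl, h3⟩
    · exact ⟨4, by decide, h4⟩
  have ha3 : 3 ≤ (a : ℕ) := by
    have := ha (ord.symm p) (by simp only [Finset.notMem_empty, false_iff, not_not]; exact hpW)
    rw [Equiv.apply_symm_apply] at this
    omega
  have hne : ord.symm a ∉ ({ord.symm 2} : Finset (Fin 5)) := by
    rw [Finset.mem_singleton, ord.symm.injective.eq_iff]
    intro h2; rw [h2] at ha3; exact absurd ha3 (by decide)
  simp only [hne, Finset.notMem_empty, decide_false]

/-- **Item stmt-ValiantsHypothesis-19536 `SeparableDescentCertificatesExist` is FALSE (verbatim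
signature negated): refuted-substantive by the antipodal star `h = 5`, `r = 6`.** -/
theorem not_separableDescentCertificatesExist :
    ¬ (∀ (h r : ℕ) (u w : Fin r → Finset (Fin h)), Function.Injective u → Function.Injective w → ∃ (ord : Equiv.Perm (Fin h)) (F G : Fin h → Bool → ℕ) (π₀ : Equiv.Perm (Fin r)), (∀ j, (∃ i, u i = w j) → u (π₀ j) = w j) ∧ ∀ σ : Equiv.Perm (Fin r), (∀ j, (∃ i, u i = w j) → u (σ j) = w j) → σ ≠ π₀ → (∑ j ∈ Finset.univ.filter (fun j => ∀ i, u i ≠ w j), (sInf ((fun a : Fin h => F a (decide (ord.symm a ∈ u (π₀ j)))) '' {a : Fin h | ∀ m : Fin h, (m ∈ u (π₀ j) ↔ m ∉ w j) → ((ord m : Fin h) : ℕ) ≤ (a : ℕ)}) + sInf ((fun c : Fin h => G c (decide (ord.symm c ∈ w j))) '' {c : Fin h | ∀ m : Fin h, (m ∈ u (π₀ j) ↔ m ∉ w j) → (c : ℕ) ≤ ((ord m : Fin h) : ℕ)}))) < (∑ j ∈ Finset.univ.filter (fun j => ∀ i, u i ≠ w j), (sInf ((fun a : Fin h => F a (decide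 (ord.symm a ∈ u (σ j)))) '' {a : Fin h | ∀ m : Fin h, (m ∈ u (σ j) ↔ m ∉ w j) → ((ord m : Fin h) : ℕ) ≤ (a : ℕ)}) + sInf ((fun c : Fin h => G c (decide (ord.symm c ∈ w j))) '' {c : Fin h | ∀ m : Fin h, (m ∈ u (σ j) ↔ m ∉ w j) → (c : ℕ) ≤ ((ord m : Fin h) : ℕ)})))) := by
  intro H
  -- the antipodal star at h = 5 (scaffold as in `BarrierLeverDescentCertificatesFail`)
  have hU : Function.Injective
      (![∅, {0}, {1}, {2}, {3}, {4}] : Fin 6 → Finset (Fin 5)) := by decide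
  have hWi : Function.Injective
      (![univ.erase 0, univ.erase 1, univ.erase 2, univ.erase 3, univ.erase 4, univ] :
        Fin 6 → Finset (Fin 5)) := by decide
  have hnomatch : ∀ j i : Fin 6, (![∅, {0}, {1}, {2}, {3}, {4}] : Fin 6 → Finset (Fin 5)) i ≠
      (![univ.erase 0, univ.erase 1, univ.erase 2, univ.erase 3, univ.erase 4, univ] :
        Fin 6 → Finset (Fin 5)) j := by decide
  have hcover : ∀ (j : Fin 6) (y z : Fin 5), y ≠ z →
      y ∈ (![univ.erase 0, univ.erase 1, univ.erase 2, univ.erase 3, univ.erase 4, univ] :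
        Fin 6 → Finset (Fin 5)) j ∨
      z ∈ (![univ.erase 0, univ.erase 1, univ.erase 2, univ.erase 3, univ.erase 4, univ] :
        Fin 6 → Finset (Fin 5)) j := by decide
  have hzero : (![∅, {0}, {1}, {2}, {3}, {4}] : Fin 6 → Finset (Fin 5)) 0 = ∅ := rfl
  have hsucc : ∀ y : Fin 5, (![∅, {0}, {1}, {2}, {3}, {4}] : Fin 6 → Finset (Fin 5)) y.succ = {y} := by
    decide
  obtain ⟨ord, F, G, π₀, -, hstrict⟩ := H 5 6 _ _ hU hWi
  set u : Fin 6 → Finset (Fin 5) := ![∅, {0}, {1}, {2}, {3}, {4}] with hu_def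
  set w : Fin 6 → Finset (Fin 5) :=
    ![univ.erase 0, univ.erase 1, univ.erase 2, univ.erase 3, univ.erase 4, univ] with hw_def
  -- the two indistinguishable rows `∅ = u 0` and `{x} = u x.succ`, `x = ord⁻¹ 2`
  set x : Fin 5 := ord.symm 2 with hx
  set j₁ : Fin 6 := π₀.symm 0 with hj₁
  set j₂ : Fin 6 := π₀.symm x.succ with hj₂
  have hπ1 : π₀ j₁ = 0 := π₀.apply_symm_apply 0
  have hπ2 : π₀ j₂ = x.succ := π₀.apply_symm_apply _
  have hj12 : j₁ ≠ j₂ := by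
    intro hh
    have := hπ1.symm.trans ((congrArg π₀ hh).trans hπ2)
    exact (Fin.succ_ne_zero x) this.symm
  set σ : Equiv.Perm (Fin 6) := π₀ * Equiv.swap j₁ j₂ with hσ
  have hσ1 : σ j₁ = x.succ := by
    rw [hσ, Equiv.Perm.mul_apply, Equiv.swap_apply_left, hπ2]
  have hσ2 : σ j₂ = 0 := by
    rw [hσ, Equiv.Perm.mul_apply, Equiv.swap_apply_right, hπ1]
  have hσ3 : ∀ j, j ≠ j₁ → j ≠ j₂ → σ j = π₀ j := fun j h1 h2 => by
    rw [hσ, Equiv.Perm.mul_apply, Equiv.swap_apply_of_ne_of_ne h1 h2]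
  have hne : σ ≠ π₀ := by
    intro hh
    have h1 : σ j₁ = π₀ j₁ := by rw [hh]
    rw [hσ1, hπ1] at h1
    exact Fin.succ_ne_zero x h1
  have hlt := hstrict σ (fun j hj => by obtain ⟨i, hi⟩ := hj; exact absurd hi (hnomatch j i)) hne
  refine absurd hlt (not_lt.mpr (le_of_eq ?_))
  refine Finset.sum_congr rfl fun j _ => ?_
  by_cases h1 : j = j₁
  · rw [h1, hσ1, hπ1, hsucc, hzero]
    exact sep_terms_eq ord F G (w j₁) (hcover j₁)
  · by_cases h2 : j = j₂
    · rw [h2, hσ2, hπ2, hsucc, hzero]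
      exact (sep_terms_eq ord F G (w j₂) (hcover j₂)).symm
    · rw [hσ3 j h1 h2]

end Summit.ValiantsHypothesis.ValiantsHypothesis.Theorems.BarrierLever.SeparableDescentFail
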